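import Literature.Geometry.Kaehler.ComplexTorusAutomorphismOrder
import Literature.NumberTheory.ComplexMultiplication.CMTypeTorusAbelianVariety
import Literature.NumberTheory.ComplexMultiplication.CMTypeTorusEndomorphisms
import Literature.NumberTheory.ComplexMultiplication.CMTypeCount
import Mathlib.NumberTheory.NumberField.CMField
import Mathlib.NumberTheory.NumberField.Cyclotomic.Basic
import HarnessLib

/-!
# An abelian threefold with an automorphism of order `30`: the corrected clause "`n ≤ 30` for
# `g = 3`" of Lange 2023, §2.4.5 Exercise (10) is sharp

Layer `Literature/Geometry/Kaehler`, namespace `Literature.Geometry.Kaehler.ComplexTorus`, lane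
`lit-hodgefound`; the sequel of `ComplexTorusAutomorphismOrder` (§4: every endomorphism of finite
order `n` of a complex torus of dimension `g ≤ 3` has `n ≤ 30`; §3: order `24` occurs on
`(E_i × E_i) × E_ω`; §5: orders `4`, `6`, `12` occur for `g = 1, 1, 2`). Here the remaining witness:
**the abelian threefold `S × E_ω`, `S = ℂ^Φ/Φ(𝓞_K)` the CM abelian surface of the cyclotomic field
`K = ℚ(ζ₅)` (any CM type `Φ`), carries the holomorphic group automorphism
`((z_φ)_φ, w) ↦ ((φ(ζ₅) z_φ)_φ, −ω w)` of order exactly `lcm(5, 6) = 30`** — so `30 = max Ord₆`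
(Bamberg–Cairns–Kilminster 2003, Table 1: `ψ⁻¹{6} = {7, 9, 14, 15, 18, 20, 24, 30}`) is attained by an
automorphism of an abelian variety of dimension `3`, and the three corrected clauses `n ≤ 6, 12, 30`
of Exercise (10) are all sharp.

The CM side is the tree's Shimura §6 vocabulary (`Literature.NumberTheory.ComplexMultiplication.
CMTypeLattice`): `periodIso Φ I : ℝ^ι ≃L[ℝ] ℂ^Φ` presents `ℂ^Φ/Φ(I)`, which is an abelian variety
(`isAbelianVariety_periodIso`, Shimura 1998 §6.2 Thm. 3), and `a ∈ 𝓞_K` acts by the integer matrix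
`mulMatrix I a` whose analytic representation is `diag(φ(a))_φ` (`periodIso_mulMatrix_mulVec`,
`mulMatrixHom_injective`). Definitions with bodies (the data of the example: `cmTypeFive`, `zetaFive`,
`surfaceFivePeriod`, `threefoldThirtyPeriod`, `autThirtyMatrix`, `autThirtyLift`) and theorems; no
named fact.

## Main statements

* `orderOf_zetaFive` — `ζ₅ ∈ 𝓞_K` has multiplicative order `5`; `orderOf_mulMatrix_zetaFive` — so has
  its rational representation `ι(ζ₅) ∈ M₄(ℤ)`;
* `orderOf_autThirtyMatrix` — `A = diag(ι(ζ₅), −R_ω) ∈ M₆(ℤ)` has order `30`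
  (`orderOf_fromBlocks_diagonal`: the order of a block-diagonal matrix is the `lcm`);
* `isAbelianVariety_threefoldThirty`, `finrank_threefoldThirty` (`dim_ℂ = 3`),
  `contMDiff_mapMatrix_autThirtyMatrix` (holomorphic, with the `ℂ`-linear lift `autThirtyLift`),
  `bijective_mapMatrix_autThirtyMatrix`, `iterate_mapMatrix_autThirtyMatrix(_ne_id)`;
* **`exists_automorphism_order_thirty_threefold`** — the packaged witness, and
  **`sharp_le_of_iterate_mapMatrix_eq_id_of_finrank_le_three`**: the bound `n ≤ 30` of
  `le_of_iterate_mapMatrix_eq_id_of_finrank_le` (dimension `≤ 3`) is attained.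

## References

* [Lange2023AbelianVarietiesComplex] H. Lange, *Abelian Varieties over the Complex Numbers* (2023),
  §2.4.5 Exercise (10) (erratum) and §1.1.2 (rational / analytic representations).
* [BambergCairnsKilminster2003] J. Bamberg, G. Cairns, D. Kilminster, Amer. Math. Monthly 110 (2003),
  Thm. 1 and Table 1.
* [Shimura1998] G. Shimura, *Abelian Varieties with Complex Multiplication and Modular Functions*
  (1998), §6.1 Thm. 2, §6.2 Thm. 3 — via the tree's `CMTypeLattice`.
-/

noncomputable section

open Complex Function Module NumberField
open scoped Manifold ContDiff nonZeroDivisors Classical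

namespace Literature.Geometry.Kaehler.ComplexTorus

open Literature.NumberTheory.ComplexMultiplication Literature.NumberTheory.ComplexMultiplication.CMTypeLattice
open Literature.AlgebraicGeometry.Motives (CMType)

/-! ### The order of a block-diagonal integer matrix -/

/-- **`ord diag(B, C) = lcm(ord B, ord C)`** for square integer matrices (the block-diagonal embedding
`M × M' →* M ⊕ M'` is an injective monoid homomorphism; `Prod.orderOf`). [folklore] -/
private theorem orderOf_fromBlocks_diagonal {κ κ' : Type*} [Fintype κ] [Fintype κ'] [DecidableEq κ]
    [DecidableEq κ'] (B : Matrix κ κ ℤ) (C : Matrix κ' κ' ℤ) :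
    orderOf (Matrix.fromBlocks B 0 0 C) = Nat.lcm (orderOf B) (orderOf C) := by
  let F : Matrix κ κ ℤ × Matrix κ' κ' ℤ →* Matrix (κ ⊕ κ') (κ ⊕ κ') ℤ :=
    { toFun := fun p ↦ Matrix.fromBlocks p.1 0 0 p.2
      map_one' := Matrix.fromBlocks_one
      map_mul' := fun p q ↦ by simp [Matrix.fromBlocks_multiply] }
  have hF : Injective F := fun p q h ↦ by
    obtain ⟨h1, -, -, h2⟩ := Matrix.fromBlocks_inj.1 h
    exact Prod.ext h1 h2
  have h := orderOf_injective F hF (B, C)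
  rw [Prod.orderOf] at h
  exact h

/-! ### The CM surface of a fifth cyclotomic field `K = ℚ(ζ₅)` -/

section Five

variable (K : Type) [Field K] [NumberField K] [IsCyclotomicExtension {5} ℚ K]

/-- `ℚ(ζ₅)` is a CM field (Mathlib: a cyclotomic extension `ℚ(ζₙ)`, `n > 2`, is CM). [folklore] -/
private theorem isCMField_of_isCyclotomicExtension_five : IsCMField K :=
  IsCyclotomicExtension.Rat.isCMField K (S := {5}) ⟨5, Set.mem_singleton 5, by norm_num⟩

/-- `[ℚ(ζ₅) : ℚ] = φ(5) = 4`. [folklore] -/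
private theorem finrank_eq_four_of_isCyclotomicExtension_five : finrank ℚ K = 4 := by
  have h := IsCyclotomicExtension.finrank (K := ℚ) (n := 5) K
    (Polynomial.cyclotomic.irreducible_rat (by norm_num))
  rw [h, Nat.totient_prime (by norm_num : Nat.Prime 5)]

/-- A CM type of `ℚ(ζ₅)` (the tree's standard one; any would do). [cite: Shimura1998, §6.2 Thm. 3] -/
def cmTypeFive : CMType K :=
  haveI := isCMField_of_isCyclotomicExtension_five K
  CMTypeCount.stdCMType

/-- `#Φ = 2`: the CM torus `ℂ^Φ/Φ(𝓞_K)` of `ℚ(ζ₅)` is a SURFACE. [cite: Shimura1998, §6.2 Thm. 3] -/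
theorem card_cmTypeFive : Fintype.card (cmTypeFive K).1 = 2 := by
  have h := two_mul_card_eq_finrank (cmTypeFive K)
  rw [finrank_eq_four_of_isCyclotomicExtension_five] at h
  omega

/-- `ζ₅ ∈ 𝓞_K`, a primitive fifth root of unity. [folklore] -/
def zetaFive : 𝓞 K := (IsCyclotomicExtension.zeta_spec 5 ℚ K).toInteger

/-- `ζ₅` is a primitive `5`-th root of unity in `𝓞_K`. [folklore] -/
private theorem isPrimitiveRoot_zetaFive : IsPrimitiveRoot (zetaFive K) 5 :=
  (IsCyclotomicExtension.zeta_spec 5 ℚ K).toInteger_isPrimitiveRoot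

/-- `ord ζ₅ = 5` in `𝓞_K`. [folklore] -/
private theorem orderOf_zetaFive : orderOf (zetaFive K) = 5 := (isPrimitiveRoot_zetaFive K).eq_orderOf.symm

/-- **The rational representation `ι(ζ₅) ∈ M₄(ℤ)` of multiplication by `ζ₅` has order `5`**
(`ι : 𝓞_K → M(ℤ)` is an injective ring homomorphism). [cite: Shimura1998, §6.1 Thm. 2, p. 41] -/
theorem orderOf_mulMatrix_zetaFive : orderOf (mulMatrix (K := K) 1 (zetaFive K)) = 5 :=
  (orderOf_injective (mulMatrixHom (K := K) 1).toMonoidHom (mulMatrixHom_injective 1) (zetaFive K)).trans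
    (orderOf_zetaFive K)

/-- **The period map of the CM surface `S = ℂ^Φ/Φ(𝓞_K)`**, `K = ℚ(ζ₅)` (unit ideal).
[cite: Shimura1998, §6.2 Thm. 3, p. 42] -/
def surfaceFivePeriod : (basisIndex (K := K) 1 → ℝ) ≃L[ℝ] ((cmTypeFive K).1 → ℂ) :=
  periodIso (cmTypeFive K) 1

/-! ### The threefold `S × E_ω` and its automorphism of order `30` -/

/-- **The period map of `X = S × E_ω`.** [cite: Lange2023AbelianVarietiesComplex, §2.4.5 Exercise (10)] -/
def threefoldThirtyPeriod :
    (basisIndex (K := K) 1 ⊕ Fin 2 → ℝ) ≃L[ℝ] ((cmTypeFive K).1 → ℂ) × ℂ :=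
  prodPeriod (surfaceFivePeriod K) (ellipticPeriod omega_im_ne_zero)

/-- `Im ω > 0`. [folklore] -/
private theorem omega_im_pos' : 0 < omega.im := by
  show 0 < Real.sqrt 3 / 2
  positivity

/-- **`X = S × E_ω` is an abelian variety** (product of Shimura's Riemann form on `S` and the Riemann
form of `E_ω`). [cite: Shimura1998, §6.2 Thm. 3] [cite: Lange2023AbelianVarietiesComplex, §2.4.4 Cor. 2.4.24] -/
theorem isAbelianVariety_threefoldThirty : IsAbelianVariety (threefoldThirtyPeriod K) := by
  haveI := isCMField_of_isCyclotomicExtension_five K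
  obtain ⟨ωS, hS⟩ := isAbelianVariety_periodIso (cmTypeFive K) (1 : (FractionalIdeal (𝓞 K)⁰ K)ˣ)
  exact ⟨prodForm ωS (ellipticForm omega_im_ne_zero), hS.prod (isRiemannForm_ellipticForm omega_im_pos')⟩

/-- `dim_ℂ X = #Φ + 1 = 3`. [cite: Lange2023AbelianVarietiesComplex, §2.4.5 Exercise (10)] -/
theorem finrank_threefoldThirty : finrank ℂ (((cmTypeFive K).1 → ℂ) × ℂ) = 3 := by
  rw [Module.finrank_prod, Module.finrank_pi ℂ, Module.finrank_self, card_cmTypeFive]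

/-- **`A = diag(ι(ζ₅), −R_ω) ∈ GL₆(ℤ)`**, the rational representation of `((z_φ), w) ↦ ((φ(ζ₅) z_φ), −ω w)`.
[cite: Lange2023AbelianVarietiesComplex, §2.4.5 Exercise (10)] -/
def autThirtyMatrix : Matrix (basisIndex (K := K) 1 ⊕ Fin 2) (basisIndex (K := K) 1 ⊕ Fin 2) ℤ :=
  Matrix.fromBlocks (mulMatrix (K := K) 1 (zetaFive K)) 0 0 (-rotOmega)

/-- **`A` has order `30 = lcm(5, 6)` in `M₆(ℤ)`.** [cite: BambergCairnsKilminster2003, Thm. 1 and Table 1 (`30 ∈ Ord₆`)] -/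
theorem orderOf_autThirtyMatrix : orderOf (autThirtyMatrix K) = 30 := by
  rw [autThirtyMatrix, orderOf_fromBlocks_diagonal, orderOf_mulMatrix_zetaFive, orderOf_neg_rotOmega]
  decide

/-- The `ℂ`-linear lift `((z_φ), w) ↦ ((φ(ζ₅) z_φ), −ω w)` of `ρ(A)`.
[cite: Lange2023AbelianVarietiesComplex, §1.1.2 (analytic representation)] -/
def autThirtyLift : (((cmTypeFive K).1 → ℂ) × ℂ) →L[ℂ] ((cmTypeFive K).1 → ℂ) × ℂ :=
  ((ContinuousLinearMap.mul ℂ ((cmTypeFive K).1 → ℂ)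
      (cmEmbedding (cmTypeFive K) ((zetaFive K : 𝓞 K) : K))).comp
      (ContinuousLinearMap.fst ℂ ((cmTypeFive K).1 → ℂ) ℂ)).prod
    (((-omega) • ContinuousLinearMap.id ℂ ℂ).comp (ContinuousLinearMap.snd ℂ ((cmTypeFive K).1 → ℂ) ℂ))

/-- `autThirtyLift ((z_φ), w) = ((φ(ζ₅) z_φ), −ω w)`. [cite: Lange2023AbelianVarietiesComplex, §2.4.5 Exercise (10)] -/
@[simp] theorem autThirtyLift_apply (z : ((cmTypeFive K).1 → ℂ) × ℂ) :
    autThirtyLift K z =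
      (cmEmbedding (cmTypeFive K) ((zetaFive K : 𝓞 K) : K) * z.1,
        ((-omega) • ContinuousLinearMap.id ℂ ℂ) z.2) := by
  rcases z with ⟨z₁, z₂⟩
  simp [autThirtyLift, ContinuousLinearMap.mul_apply']

/-- The zero off-diagonal blocks act by zero after the cast `ℤ → ℝ`. [folklore] -/
private theorem map_zero_intCast {κ κ' : Type*} :
    ((0 : Matrix κ κ' ℤ).map (Int.cast : ℤ → ℝ)) = 0 := by
  ext i j
  simp

/-- `ρ(A)` lifts to `autThirtyLift`: `A` is the rational representation of `((z_φ), w) ↦ ((φ(ζ₅) z_φ), −ω w)`.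
[cite: Lange2023AbelianVarietiesComplex, §1.1.2 (rational and analytic representations)] [cite: Shimura1998, §6.2 Thm. 3, p. 42] -/
theorem threefoldThirtyPeriod_autThirtyMatrix_mulVec (x : basisIndex (K := K) 1 ⊕ Fin 2 → ℝ) :
    threefoldThirtyPeriod K (((autThirtyMatrix K).map (Int.cast : ℤ → ℝ)).mulVec x) =
      autThirtyLift K (threefoldThirtyPeriod K x) := by
  rw [autThirtyMatrix, Matrix.fromBlocks_map, map_zero_intCast, map_zero_intCast,
    Matrix.fromBlocks_mulVec, Matrix.zero_mulVec, Matrix.zero_mulVec, add_zero, zero_add,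
    autThirtyLift_apply]
  simp only [threefoldThirtyPeriod, prodPeriod_apply, Sum.elim_inl, Sum.elim_inr]
  refine Prod.ext ?_ ?_
  · exact periodIso_mulMatrix_mulVec (cmTypeFive K) 1 (zetaFive K) _
  · exact ellipticPeriod_neg_rotOmega_mulVec _

/-- **`f = ρ(A)` is holomorphic.** [cite: Lange2023AbelianVarietiesComplex, §1.1.2 Prop. 1.1.6] -/
theorem contMDiff_mapMatrix_autThirtyMatrix {n : WithTop ℕ∞} :
    ContMDiff 𝓘(ℂ, ((cmTypeFive K).1 → ℂ) × ℂ) 𝓘(ℂ, ((cmTypeFive K).1 → ℂ) × ℂ) n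
      (mapMatrix (threefoldThirtyPeriod K) (threefoldThirtyPeriod K) (autThirtyMatrix K)) :=
  contMDiff_mapMatrix (autThirtyLift K) (threefoldThirtyPeriod_autThirtyMatrix_mulVec K)

/-- **`f^[30] = id`.** [cite: Lange2023AbelianVarietiesComplex, §2.4.5 Exercise (10)] -/
theorem iterate_mapMatrix_autThirtyMatrix :
    (mapMatrix (threefoldThirtyPeriod K) (threefoldThirtyPeriod K) (autThirtyMatrix K))^[30] = id :=
  (iterate_mapMatrix_eq_id_iff (threefoldThirtyPeriod K) (autThirtyMatrix K) 30).2
    (orderOf_autThirtyMatrix K ▸ pow_orderOf_eq_one (autThirtyMatrix K))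

/-- **`f^[m] ≠ id` for `0 < m < 30`**: order exactly `30`. [cite: Lange2023AbelianVarietiesComplex, §2.4.5 Exercise (10)] [cite: BambergCairnsKilminster2003, Thm. 1 (`30 ∈ Ord₆`)] -/
theorem iterate_mapMatrix_autThirtyMatrix_ne_id {m : ℕ} (hm0 : 0 < m) (hm : m < 30) :
    (mapMatrix (threefoldThirtyPeriod K) (threefoldThirtyPeriod K) (autThirtyMatrix K))^[m] ≠ id := by
  intro h
  have hA : autThirtyMatrix K ^ m = 1 :=
    (iterate_mapMatrix_eq_id_iff (threefoldThirtyPeriod K) (autThirtyMatrix K) m).1 h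
  have := orderOf_le_of_pow_eq_one hm0 hA
  rw [orderOf_autThirtyMatrix] at this
  omega

/-- `f` is bijective (an automorphism of `X`). [cite: Lange2023AbelianVarietiesComplex, §2.4.5 Exercise (10)] -/
theorem bijective_mapMatrix_autThirtyMatrix :
    Bijective (mapMatrix (threefoldThirtyPeriod K) (threefoldThirtyPeriod K) (autThirtyMatrix K)) := by
  set f := mapMatrix (threefoldThirtyPeriod K) (threefoldThirtyPeriod K) (autThirtyMatrix K) with hf
  have h30 : f^[30] = id := iterate_mapMatrix_autThirtyMatrix K
  have hl : LeftInverse (f^[29]) f := fun x ↦ by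
    have := congrFun h30 x
    rwa [show (30 : ℕ) = 29 + 1 from rfl, iterate_succ, comp_apply] at this
  have hr : RightInverse (f^[29]) f := fun x ↦ by
    have := congrFun h30 x
    rwa [iterate_succ', comp_apply] at this
  exact ⟨hl.injective, hr.surjective⟩

/-- **An abelian threefold with a holomorphic group automorphism of order exactly `30`**:
`X = S × E_ω`, `S = ℂ^Φ/Φ(𝓞_K)` for `K = ℚ(ζ₅)`, `f((z_φ), w) = ((φ(ζ₅) z_φ), −ω w)`.
[cite: Lange2023AbelianVarietiesComplex, §2.4.5 Exercise (10)] [cite: BambergCairnsKilminster2003, Thm. 1 and Table 1 (`ψ⁻¹{6} ∋ 30`)] -/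
theorem exists_automorphism_order_thirty_threefold :
    IsAbelianVariety (threefoldThirtyPeriod K) ∧ finrank ℂ (((cmTypeFive K).1 → ℂ) × ℂ) = 3 ∧
      ContMDiff 𝓘(ℂ, ((cmTypeFive K).1 → ℂ) × ℂ) 𝓘(ℂ, ((cmTypeFive K).1 → ℂ) × ℂ) ω
        (mapMatrix (threefoldThirtyPeriod K) (threefoldThirtyPeriod K) (autThirtyMatrix K)) ∧
      Bijective (mapMatrix (threefoldThirtyPeriod K) (threefoldThirtyPeriod K) (autThirtyMatrix K)) ∧
      (∀ x y, mapMatrix (threefoldThirtyPeriod K) (threefoldThirtyPeriod K) (autThirtyMatrix K) (x + y) =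
        mapMatrix (threefoldThirtyPeriod K) (threefoldThirtyPeriod K) (autThirtyMatrix K) x +
          mapMatrix (threefoldThirtyPeriod K) (threefoldThirtyPeriod K) (autThirtyMatrix K) y) ∧
      (mapMatrix (threefoldThirtyPeriod K) (threefoldThirtyPeriod K) (autThirtyMatrix K))^[30] = id ∧
      ∀ m, 0 < m → m < 30 →
        (mapMatrix (threefoldThirtyPeriod K) (threefoldThirtyPeriod K) (autThirtyMatrix K))^[m] ≠ id :=
  ⟨isAbelianVariety_threefoldThirty K, finrank_threefoldThirty K, contMDiff_mapMatrix_autThirtyMatrix K,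
    bijective_mapMatrix_autThirtyMatrix K, mapMatrix_add (autThirtyMatrix K),
    iterate_mapMatrix_autThirtyMatrix K, fun _ hm0 hm ↦ iterate_mapMatrix_autThirtyMatrix_ne_id K hm0 hm⟩

/-- **The corrected clause "`n ≤ 30` for `g = 3`" is sharp**: the bound of
`le_of_iterate_mapMatrix_eq_id_of_finrank_le` holds for every finite-order endomorphism
`mapMatrix _ _ A` of `X` (dimension `3`) and is attained by `f = ρ(autThirtyMatrix)`.
[cite: Lange2023AbelianVarietiesComplex, §2.4.5 Exercise (10)] [cite: BambergCairnsKilminster2003, Thm. 1 and Table 1] -/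
theorem sharp_le_of_iterate_mapMatrix_eq_id_of_finrank_le_three :
    (∀ (A : Matrix (basisIndex (K := K) 1 ⊕ Fin 2) (basisIndex (K := K) 1 ⊕ Fin 2) ℤ) (n : ℕ),
        0 < n → (mapMatrix (threefoldThirtyPeriod K) (threefoldThirtyPeriod K) A)^[n] = id →
        (∀ m, 0 < m → m < n →
          (mapMatrix (threefoldThirtyPeriod K) (threefoldThirtyPeriod K) A)^[m] ≠ id) → n ≤ 30) ∧
      (mapMatrix (threefoldThirtyPeriod K) (threefoldThirtyPeriod K) (autThirtyMatrix K))^[30] = id ∧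
      ∀ m, 0 < m → m < 30 →
        (mapMatrix (threefoldThirtyPeriod K) (threefoldThirtyPeriod K) (autThirtyMatrix K))^[m] ≠ id :=
  ⟨fun _ _ hn hper hmin ↦
      (le_of_iterate_mapMatrix_eq_id_of_finrank_le (threefoldThirtyPeriod K) hn hper hmin).2.2
        (finrank_threefoldThirty K).le,
    iterate_mapMatrix_autThirtyMatrix K, fun _ hm0 hm ↦ iterate_mapMatrix_autThirtyMatrix_ne_id K hm0 hm⟩

end Five

/-- `CyclotomicField 5 ℚ` is a `5`-th cyclotomic extension of `ℚ` (Mathlib's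
`CyclotomicField.isCyclotomicExtension`, registered here as an instance: the generic instance needs
`NeZero ((5 : ℕ) : ℚ)`, which instance search does not find by itself). [folklore] -/
instance isCyclotomicExtension_cyclotomicField_five : IsCyclotomicExtension {5} ℚ (CyclotomicField 5 ℚ) :=
  CyclotomicField.isCyclotomicExtension 5 ℚ

/-- Non-vacuity: the fifth cyclotomic field `CyclotomicField 5 ℚ` is an instance, so an abelian
threefold with an automorphism of order `30` EXISTS. [cite: BambergCairnsKilminster2003, Thm. 1 and Table 1] -/
theorem exists_automorphism_order_thirty_threefold_cyclotomicField :
    IsAbelianVariety (threefoldThirtyPeriod (CyclotomicField 5 ℚ)) ∧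
      finrank ℂ (((cmTypeFive (CyclotomicField 5 ℚ)).1 → ℂ) × ℂ) = 3 ∧
      (mapMatrix (threefoldThirtyPeriod (CyclotomicField 5 ℚ)) (threefoldThirtyPeriod (CyclotomicField 5 ℚ))
          (autThirtyMatrix (CyclotomicField 5 ℚ)))^[30] = id ∧
      ∀ m, 0 < m → m < 30 →
        (mapMatrix (threefoldThirtyPeriod (CyclotomicField 5 ℚ)) (threefoldThirtyPeriod (CyclotomicField 5 ℚ))
          (autThirtyMatrix (CyclotomicField 5 ℚ)))^[m] ≠ id :=
  ⟨isAbelianVariety_threefoldThirty _, finrank_threefoldThirty _, iterate_mapMatrix_autThirtyMatrix _,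
    fun _ hm0 hm ↦ iterate_mapMatrix_autThirtyMatrix_ne_id _ hm0 hm⟩

end Literature.Geometry.Kaehler.ComplexTorus

end
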